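import Summits.MatrixMultiplication.MatrixMultiplication.Theorems.ObstructionDescentUniversalOccurrenceTwoRectangleSemiInvariance

set_option linter.dupNamespace false
set_option autoImplicit false

/-!
# Obstruction descent — universal occurrence: the determinantal semi-invariants on the orbit of `⟨N⟩` (K25)

Third part of the two-rectangle analysis of the orbit closure of the unit tensor `⟨N⟩`
(`…TwoRectangleFloor` = K23, `…TwoRectangleSemiInvariance` = K24).  K24 showed that the
two-rectangle sector `((δ^N),(δ^N),ν)` of `ℂ[σ̂(⟨N⟩)]` consists of `(det^δ, det^δ)`-semi-invariants of
`GL_N × GL_N × 1` and is detected on the diagonal slices `t₀(c)`.  The classical SOURCE of such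
semi-invariants on `ℂ^N ⊗ ℂ^N ⊗ ℂ^N = (Mat_N)^N` (an `N`-tuple of slices `T_l = t(·,·,l)`, acted on by
`T_l ↦ A T_l Bᵀ` — the `N`-Kronecker quiver) are the DETERMINANTAL semi-invariants

  `F_X(t) = det( ∑_l X_l ⊗ T_l )`,   `X = (X_1, …, X_N)` a tuple of `δ × δ` matrices,

which by Derksen–Weyman / Schofield–Van den Bergh / Domokos–Zubkov span all of them.  This file
proves, sorry-free and over the tree's `actTensor` / `unitTensor`:

* `of_actTensor₁₂_slice` — the `l`-th slice of `(A ⊗ B ⊗ 1)·t` is `A · T_l · Bᵀ`;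
* `det_sum_kronecker_slice_actTensor₁₂` — semi-invariance: `F_X((A ⊗ B ⊗ 1)·t) = det(A)^δ det(B)^δ F_X(t)`
  for ALL square `A, B` (no invertibility needed);
* `det_sum_kronecker_diagSlice` — on a diagonal slice the matrix `∑_l X_l ⊗ T_l` is block diagonal and
  `F_X(t₀(c)) = ∏_i det( ∑_l c_{i l} X_l )`: the value is the product over the rows `c_i` of the
  degree-`δ` form `P_X(y) = det(∑_l y_l X_l)`, a form with a `δ × δ` LINEAR DETERMINANTAL REPRESENTATION;
* `det_sum_kronecker_slice_orbit_unitTensor` — hence on the whole `Mat_N³`-orbit of `⟨N⟩`: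
  `F_X((A ⊗ B ⊗ C)·⟨N⟩) = det(A)^δ det(B)^δ ∏_i P_X(C^i)` (`C^i` the `i`-th column of `C`), and
* `det_sum_kronecker_slice_orbit_unitTensor_eq_zero_iff` — for invertible `A, B` the determinantal
  semi-invariant vanishes at `(A ⊗ B ⊗ C)·⟨N⟩` iff `P_X` vanishes at some column of `C`;
* `pairing_diagSlice_perm_rows` — the slice functions of two-rectangle highest-weight pairings are
  symmetric under permutations of the rows of `c` (K24 with `A = B = P_σ`): the sector restricts into
  the `S_N`-symmetric, row-wise degree-`δ` functions `Sym^N(Sym^δ ℂ^N)` (BI 2011 Thm 4.4, `m = N`).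

Consequence recorded in the lens-3 node (not formalised here): together with K24 and the spanning
theorem, the image of the sector in `Sym^N(Sym^δ ℂ^N)` is the span of the `N`-th powers of
determinantal forms, so the closure multiplicity of `((δ^N),(δ^N),ν)` is the orbit multiplicity
minus the multiplicity of `ν` in the degree-`N` equations of the variety of determinantal
degree-`δ` forms ("determinantal-form law").
-/

namespace Summit.MatrixMultiplication.MatrixMultiplication.Theorems.ObstructionCalculus

open Matrix BigOperators
open scoped Kronecker
open Literature.Computability.AlgebraicComplexity

variable {N δ : ℕ}

/-- The `l`-th slice of `(A ⊗ B ⊗ 1)·t` is `A · T_l · Bᵀ`, `T_l = t(·,·,l)`. [folklore] -/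
theorem of_actTensor₁₂_slice (A B : Matrix (Fin N) (Fin N) ℂ) (t : Fin N → Fin N → Fin N → ℂ)
    (l : Fin N) :
    Matrix.of (fun i j => actTensor A B (1 : Matrix (Fin N) (Fin N) ℂ) t i j l) =
      A * Matrix.of (fun i j => t i j l) * Bᵀ := by
  ext i j
  simp only [Matrix.of_apply, actTensor_apply, Matrix.mul_apply, Matrix.transpose_apply,
    Matrix.one_apply]
  rw [Finset.sum_comm]
  refine Finset.sum_congr rfl fun b _ => ?_
  rw [Finset.sum_mul]
  refine Finset.sum_congr rfl fun a _ => ?_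
  rw [Finset.sum_eq_single l]
  · simp only [if_true]; ring
  · intro c _ hc; simp [Ne.symm hc]
  · simp

/-- **Semi-invariance of the determinantal functions.**  For every tuple `X` of `δ × δ` matrices and
all square `A, B`:  `det(∑_l X_l ⊗ ((A ⊗ B ⊗ 1)·t)_l) = det(A)^δ · det(B)^δ · det(∑_l X_l ⊗ T_l)`.
[folklore; Domokos–Zubkov 2001, Derksen–Weyman 2000 (the determinantal semi-invariants of the Kronecker quiver)] -/
theorem det_sum_kronecker_slice_actTensor₁₂ (X : Fin N → Matrix (Fin δ) (Fin δ) ℂ)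
    (A B : Matrix (Fin N) (Fin N) ℂ) (t : Fin N → Fin N → Fin N → ℂ) :
    (∑ l, X l ⊗ₖ Matrix.of (fun i j => actTensor A B (1 : Matrix (Fin N) (Fin N) ℂ) t i j l)).det =
      A.det ^ δ * B.det ^ δ * (∑ l, X l ⊗ₖ Matrix.of (fun i j => t i j l)).det := by
  have h : ∑ l, X l ⊗ₖ Matrix.of (fun i j => actTensor A B (1 : Matrix (Fin N) (Fin N) ℂ) t i j l) =
      ((1 : Matrix (Fin δ) (Fin δ) ℂ) ⊗ₖ A) * (∑ l, X l ⊗ₖ Matrix.of (fun i j => t i j l)) *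
        ((1 : Matrix (Fin δ) (Fin δ) ℂ) ⊗ₖ Bᵀ) := by
    rw [Finset.mul_sum, Finset.sum_mul]
    refine Finset.sum_congr rfl fun l _ => ?_
    rw [of_actTensor₁₂_slice, ← mul_kronecker_mul, Matrix.one_mul, ← mul_kronecker_mul,
      Matrix.mul_one]
  rw [h, det_mul, det_mul, det_kronecker, det_kronecker, det_one, one_pow, one_mul, one_mul,
    det_transpose, Fintype.card_fin]
  ring

/-- **Slice evaluation.**  On the diagonal slice `t₀(c)` (`t₀(c)(i,j,l) = [i = j]·c_{i l}`) the matrix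
`∑_l X_l ⊗ T_l` is block diagonal with blocks `∑_l c_{i l} X_l`, so
`det(∑_l X_l ⊗ t₀(c)_l) = ∏_i det(∑_l c_{i l} X_l)` — the product over the rows of `c` of the degree-`δ`
form `P_X(y) = det(∑_l y_l X_l)` with a `δ × δ` linear determinantal representation. [folklore] -/
theorem det_sum_kronecker_diagSlice (X : Fin N → Matrix (Fin δ) (Fin δ) ℂ) (c : Fin N → Fin N → ℂ) :
    (∑ l, X l ⊗ₖ Matrix.of (fun i j : Fin N => if i = j then c i l else 0)).det =
      ∏ i, (∑ l, c i l • X l).det := by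
  have hdiag : ∀ l, Matrix.of (fun i j : Fin N => if i = j then c i l else 0) =
      diagonal (fun i => c i l) := by
    intro l
    ext i j
    simp only [Matrix.of_apply, diagonal_apply]
  simp_rw [hdiag, kronecker_diagonal]
  have hsum : ∑ l, blockDiagonal (fun i => MulOpposite.op (c i l) • X l) =
      blockDiagonal (fun i => ∑ l, c i l • X l) := by
    ext ⟨a, i⟩ ⟨b, j⟩
    simp only [Matrix.sum_apply, blockDiagonal_apply', Matrix.smul_apply, MulOpposite.smul_eq_mul_unop,
      MulOpposite.unop_op, smul_eq_mul]
    split_ifs with hij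
    · exact Finset.sum_congr rfl fun l _ => mul_comm _ _
    · simp
  rw [hsum, det_blockDiagonal]

/-- **Determinantal semi-invariants on the orbit of `⟨N⟩`.**  For all `A, B, C ∈ Mat_N(ℂ)` and every
tuple `X` of `δ × δ` matrices,
`det(∑_l X_l ⊗ ((A ⊗ B ⊗ C)·⟨N⟩)_l) = det(A)^δ · det(B)^δ · ∏_i det(∑_l C_{l i} X_l)`:
the value is `det(A)^δ det(B)^δ` times the product of the determinantal form `P_X` over the columns
of `C`. [this node; ingredients folklore + BI 2011 §4] -/
theorem det_sum_kronecker_slice_orbit_unitTensor (X : Fin N → Matrix (Fin δ) (Fin δ) ℂ)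
    (A B C : Matrix (Fin N) (Fin N) ℂ) :
    (∑ l, X l ⊗ₖ Matrix.of (fun i j => actTensor A B C (unitTensor ℂ N) i j l)).det =
      A.det ^ δ * B.det ^ δ * ∏ i, (∑ l, C l i • X l).det := by
  rw [actTensor_unitTensor_eq_actTensor_diagSlice, det_sum_kronecker_slice_actTensor₁₂]
  exact congrArg _ (det_sum_kronecker_diagSlice X (fun i l => C l i))

/-- For invertible `A, B` the determinantal semi-invariant `F_X` vanishes at the orbit point
`(A ⊗ B ⊗ C)·⟨N⟩` iff the determinantal form `P_X(y) = det(∑_l y_l X_l)` vanishes at some column of `C`.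
[this node] -/
theorem det_sum_kronecker_slice_orbit_unitTensor_eq_zero_iff (X : Fin N → Matrix (Fin δ) (Fin δ) ℂ)
    (A B C : Matrix (Fin N) (Fin N) ℂ) (hA : A.det ≠ 0) (hB : B.det ≠ 0) :
    (∑ l, X l ⊗ₖ Matrix.of (fun i j => actTensor A B C (unitTensor ℂ N) i j l)).det = 0 ↔
      ∃ i, (∑ l, C l i • X l).det = 0 := by
  rw [det_sum_kronecker_slice_orbit_unitTensor, mul_eq_zero, mul_eq_zero, Finset.prod_eq_zero_iff]
  simp only [pow_eq_zero_iff', hA, hB, ne_eq, false_and, false_or, Finset.mem_univ, true_and]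

/-- At the base point (`A = B = C = 1`) the determinantal semi-invariant of `X` takes the value
`∏_i det(X_i)`; in particular `F_X` does not vanish on the orbit of `⟨N⟩` as soon as every `X_i` is
invertible — the two-rectangle sector of `ℂ[GL_N³·⟨N⟩]` is non-zero in every degree `Nδ`. [this node] -/
theorem det_sum_kronecker_slice_unitTensor (X : Fin N → Matrix (Fin δ) (Fin δ) ℂ) :
    (∑ l, X l ⊗ₖ Matrix.of (fun i j => unitTensor ℂ N i j l)).det = ∏ i, (X i).det := by
  have h : (fun i j l : Fin N => unitTensor ℂ N i j l) =
      fun i j l : Fin N => if i = j then (if i = l then (1 : ℂ) else 0) else 0 := by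
    funext i j l
    simp only [unitTensor_apply]
    by_cases hij : i = j
    · subst hij
      by_cases hil : i = l
      · subst hil; simp
      · simp [hil]
    · simp [hij]
  have h' : (∑ l, X l ⊗ₖ Matrix.of (fun i j => unitTensor ℂ N i j l)) =
      ∑ l, X l ⊗ₖ Matrix.of (fun i j : Fin N => if i = j then (if i = l then (1 : ℂ) else 0) else 0) := by
    refine Finset.sum_congr rfl fun l _ => ?_
    congr 1
    ext i j
    simp only [Matrix.of_apply]
    exact congrFun (congrFun (congrFun h i) j) l
  rw [h', det_sum_kronecker_diagSlice X (fun i l => if i = l then (1 : ℂ) else 0)]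
  refine Finset.prod_congr rfl fun i _ => ?_
  congr 1
  rw [Finset.sum_eq_single i]
  · simp
  · intro l _ hl
    simp [Ne.symm hl]
  · simp

/-- The simultaneous row permutation `(P_σ ⊗ P_σ ⊗ 1)` maps the diagonal slice `t₀(c)` to the diagonal
slice of the row-permuted matrix `c ∘ σ`. [folklore] -/
theorem actTensor_perm_perm_diagSlice (σ : Equiv.Perm (Fin N)) (c : Fin N → Fin N → ℂ) :
    actTensor (Matrix.of fun i a : Fin N => if a = σ i then (1 : ℂ) else 0)
        (Matrix.of fun i a : Fin N => if a = σ i then (1 : ℂ) else 0) (1 : Matrix (Fin N) (Fin N) ℂ)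
        (fun i j l : Fin N => if i = j then c i l else 0) =
      fun i j l : Fin N => if i = j then c (σ i) l else 0 := by
  funext i j l
  simp only [actTensor_apply, Matrix.of_apply, Matrix.one_apply]
  rw [Finset.sum_eq_single (σ i) (fun a _ ha => by simp [ha]) (by simp)]
  rw [Finset.sum_eq_single (σ j) (fun b _ hb => by simp [hb]) (by simp)]
  rw [Finset.sum_eq_single l (fun c' _ hc => by simp [Ne.symm hc]) (by simp)]
  by_cases hij : i = j
  · subst hij; simp
  · have : σ i ≠ σ j := fun h => hij (σ.injective h)
    simp [hij, this]

/-- The permutation matrices used above are orthogonal: `P_σ P_σᵀ = 1`. [folklore] -/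
theorem perm_of_mul_transpose (σ : Equiv.Perm (Fin N)) :
    (Matrix.of fun i a : Fin N => if a = σ i then (1 : ℂ) else 0) *
        (Matrix.of fun i a : Fin N => if a = σ i then (1 : ℂ) else 0)ᵀ = 1 := by
  ext i j
  simp only [Matrix.mul_apply, Matrix.transpose_apply, Matrix.of_apply, Matrix.one_apply]
  rw [Finset.sum_eq_single (σ i) (fun a _ ha => by simp [ha]) (by simp)]
  by_cases hij : i = j
  · subst hij; simp
  · have : σ i ≠ σ j := fun h => hij (σ.injective h)
    simp [hij, this]

/-- **`S_N`-symmetry of the slice functions** (ingredient (E) of the determinantal-form law): a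
two-rectangle highest-weight pairing takes the same value on the diagonal slices of `c` and of any
row permutation `c ∘ σ` — by K24's semi-invariance with `A = B = P_σ`, `det(P_σ)^{2δ} = 1`.  Hence the
restriction of the sector to the slice lands in the `S_N`-symmetric functions of the rows
(`Sym^N(Sym^δ ℂ^N)`, BI 2011 Thm 4.4 with `m = N`). [this node] -/
theorem pairing_diagSlice_perm_rows {f : Literature.NumberTheory.DiophantineGeometry.Word3 N (N * δ) → ℂ}
    (h1 : ∀ v w, (fun u => f ((u, v), w)) ∈
      Literature.NumberTheory.DiophantineGeometry.highestWeightSpace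
        (Literature.NumberTheory.DiophantineGeometry.wordRep ℂ N (N * δ))
        (Literature.NumberTheory.DiophantineGeometry.Weight.ofPartition N (Nat.Partition.rectangle N δ)))
    (h2 : ∀ u w, (fun v => f ((u, v), w)) ∈
      Literature.NumberTheory.DiophantineGeometry.highestWeightSpace
        (Literature.NumberTheory.DiophantineGeometry.wordRep ℂ N (N * δ))
        (Literature.NumberTheory.DiophantineGeometry.Weight.ofPartition N (Nat.Partition.rectangle N δ)))
    (σ : Equiv.Perm (Fin N)) (c : Fin N → Fin N → ℂ) :
    ∑ u, ∑ v, ∑ w, kroneckerPow (fun i j l : Fin N => if i = j then c (σ i) l else 0) (N * δ) u v w *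
        f ((u, v), w) =
      ∑ u, ∑ v, ∑ w, kroneckerPow (fun i j l : Fin N => if i = j then c i l else 0) (N * δ) u v w *
        f ((u, v), w) := by
  set P : Matrix (Fin N) (Fin N) ℂ := Matrix.of fun i a : Fin N => if a = σ i then (1 : ℂ) else 0
    with hPdef
  have hPP : P.det * P.det = 1 := by
    have h := congrArg Matrix.det (perm_of_mul_transpose (N := N) σ)
    rwa [det_mul, det_transpose, det_one] at h
  have hP : P.det ≠ 0 := fun h0 => by
    rw [h0, zero_mul] at hPP
    exact zero_ne_one hPP
  rw [← actTensor_perm_perm_diagSlice σ c, pairing_kroneckerPow_actTensor₁₂_of_rectangle h1 h2 hP hP,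
    ← mul_pow, hPP, one_pow, one_mul]

end Summit.MatrixMultiplication.MatrixMultiplication.Theorems.ObstructionCalculus
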